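import Literature.NumberTheory.LFunctions.WeilExplicit
import Mathlib.Analysis.SpecialFunctions.Integrability.Basic
import Mathlib.MeasureTheory.Integral.ExpDecay
import Mathlib.NumberTheory.Harmonic.EulerMascheroni
import Mathlib.Analysis.Calculus.MeanValue
import Mathlib.Analysis.SpecialFunctions.Trigonometric.DerivHyp
import Mathlib.Analysis.Real.Pi.Bounds
import Mathlib.Analysis.Complex.ExponentialBounds
import HarnessLib

/-!
# Crux `GroundBarta.GroundBartaFloor` (stmt-RiemannHypothesis-18389), line `inner-cutoff-strong-EL`:
stub 5 (`stub_groundArchBound`) — the positive part of Bombieri's archimedean term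

Bombieri's form of the archimedean term of Weil's explicit formula is
`W_∞(g) = -((log 4π + γ) g(0) + ∫₀^∞ (e^{t/2}(g(t) + g(-t)) - 2g(0)) / (2 sinh t) dt)`
(`Literature.NumberTheory.LFunctions.weilArchTermBombieri`).  For a NON-NEGATIVE bounded `C¹`
function `g` with `|g'| ≤ S` and `m = g(0)`: `g(±t) ≥ m - St`, so the integrand is
`≥ -min(m, St)/sinh t ≥ -m^{3/4} S^{1/4} · t^{1/4}/sinh t`, whence
`Re W_∞(g) ≤ K₀ m^{3/4} S^{1/4} = K₀ (m (m S)^{1/2})^{1/2}` with the absolute constant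
`K₀ = ∫₀^∞ t^{1/4}/sinh t dt < ∞` (`t^{-3/4}` near `0`, `8e^{-t/2}` beyond `1`).  This is the price
of an inner (window-supported) probe in Barta's argument: the collar pairing does not vanish at `0`,
and its archimedean term is controlled by the collar mass `m` against the slope `S`.
RH-free; Mathlib + the definition of `weilArchTermBombieri` only.
-/

set_option linter.dupNamespace false

noncomputable section

open Set MeasureTheory Filter Complex Real
open scoped Topology

namespace Summit.RiemannHypothesis.RiemannHypothesis.Theorems.GroundBartaFloor

open Literature.NumberTheory.LFunctions

/-! ## The absolute majorant `t^{1/4} / sinh t` -/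

/-- `sinh t ≥ e^t / 4` for `t ≥ 1`. -/
theorem ic_exp_div_four_le_sinh {t : ℝ} (ht : 1 ≤ t) : Real.exp t / 4 ≤ Real.sinh t := by
  rw [Real.sinh_eq]
  have h1 : Real.exp (-t) ≤ 1 / 2 := by
    have h2 : Real.exp (-t) ≤ Real.exp (-1) := Real.exp_le_exp.2 (by linarith)
    have h3 : Real.exp (-1) * Real.exp 1 = 1 := by rw [← Real.exp_add]; simp
    have h4 : (2 : ℝ) < Real.exp 1 := lt_trans (by norm_num) Real.exp_one_gt_d9
    nlinarith [Real.exp_pos (-1)]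
  have h5 : (1 : ℝ) ≤ Real.exp t := Real.one_le_exp (by linarith)
  linarith

/-- On `[1, ∞)`: `t^{1/4}/sinh t ≤ 8 e^{-t/2}`. -/
theorem ic_archMajorant_le_exp {t : ℝ} (ht : 1 ≤ t) :
    t ^ (1 / 4 : ℝ) / Real.sinh t ≤ 8 * Real.exp (-(1 / 2) * t) := by
  have hsinh : 0 < Real.sinh t := Real.sinh_pos_iff.2 (by linarith)
  have h1 : t ^ (1 / 4 : ℝ) ≤ t := by
    have := Real.rpow_le_rpow_of_exponent_le ht (show (1 / 4 : ℝ) ≤ 1 by norm_num)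
    rwa [Real.rpow_one] at this
  have h2 : t ≤ 2 * Real.exp (t / 2) := by
    have := Real.add_one_le_exp (t / 2)
    linarith
  have h3 : Real.exp t / 4 ≤ Real.sinh t := ic_exp_div_four_le_sinh ht
  rw [div_le_iff₀ hsinh]
  have h4 : Real.exp (-(1 / 2) * t) * Real.exp t = Real.exp (t / 2) := by
    rw [← Real.exp_add]; congr 1; ring
  have h5 : Real.exp (t / 2) * Real.exp (t / 2) = Real.exp t := by
    rw [← Real.exp_add]; congr 1; ring
  calc t ^ (1 / 4 : ℝ) ≤ t := h1
    _ ≤ 2 * Real.exp (t / 2) := h2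
    _ = 8 * Real.exp (-(1 / 2) * t) * (Real.exp t / 4) := by
        rw [show 8 * Real.exp (-(1 / 2) * t) * (Real.exp t / 4) =
          2 * (Real.exp (-(1 / 2) * t) * Real.exp t) by ring, h4]
    _ ≤ 8 * Real.exp (-(1 / 2) * t) * Real.sinh t := by
        exact mul_le_mul_of_nonneg_left h3 (by positivity)

/-- On `(0, 1]`: `t^{1/4}/sinh t ≤ t^{-3/4}`. -/
theorem ic_archMajorant_le_rpow {t : ℝ} (ht : 0 < t) :
    t ^ (1 / 4 : ℝ) / Real.sinh t ≤ t ^ (-(3 / 4) : ℝ) := by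
  have hsinh : 0 < Real.sinh t := Real.sinh_pos_iff.2 ht
  have h1 : t ≤ Real.sinh t := Real.self_le_sinh_iff.2 ht.le
  calc t ^ (1 / 4 : ℝ) / Real.sinh t ≤ t ^ (1 / 4 : ℝ) / t :=
        div_le_div_of_nonneg_left (Real.rpow_nonneg ht.le _) ht h1
    _ = t ^ (-(3 / 4) : ℝ) := by
        rw [div_eq_mul_inv, ← Real.rpow_neg_one, ← Real.rpow_add ht]; norm_num

/-- `t ↦ t^{1/4}/sinh t` is continuous on `(0, ∞)`. -/
theorem ic_continuousOn_archMajorant :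
    ContinuousOn (fun t : ℝ => t ^ (1 / 4 : ℝ) / Real.sinh t) (Ioi 0) :=
  ((Real.continuous_rpow_const (by norm_num)).continuousOn).div Real.continuous_sinh.continuousOn
    fun t ht => (Real.sinh_pos_iff.2 (mem_Ioi.1 ht)).ne'

/-- **Integrability of the absolute majorant** `t^{1/4}/sinh t` on `(0, ∞)`. -/
theorem ic_integrableOn_archMajorant :
    IntegrableOn (fun t : ℝ => t ^ (1 / 4 : ℝ) / Real.sinh t) (Ioi 0) := by
  have hmeas : ∀ s ⊆ Ioi (0 : ℝ), MeasurableSet s →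
      AEStronglyMeasurable (fun t : ℝ => t ^ (1 / 4 : ℝ) / Real.sinh t) (volume.restrict s) :=
    fun s hs hsm => (ic_continuousOn_archMajorant.mono hs).aestronglyMeasurable hsm
  rw [← Ioc_union_Ioi_eq_Ioi zero_le_one]
  refine IntegrableOn.union ?_ ?_
  · -- `(0, 1]`: dominated by `t^{-3/4}`
    have hI : IntegrableOn (fun t : ℝ => t ^ (-(3 / 4) : ℝ)) (Ioc 0 1) :=
      (intervalIntegrable_iff_integrableOn_Ioc_of_le zero_le_one).1
        (intervalIntegral.intervalIntegrable_rpow' (by norm_num))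
    refine hI.mono' (hmeas _ Ioc_subset_Ioi_self measurableSet_Ioc) ?_
    refine (ae_restrict_iff' measurableSet_Ioc).2 (ae_of_all _ fun t ht => ?_)
    rw [Real.norm_eq_abs, abs_of_nonneg (div_nonneg (Real.rpow_nonneg ht.1.le _)
      (Real.sinh_pos_iff.2 ht.1).le)]
    exact ic_archMajorant_le_rpow ht.1
  · -- `[1, ∞)`: dominated by `8 e^{-t/2}`
    have hI : IntegrableOn (fun t : ℝ => 8 * Real.exp (-(1 / 2) * t)) (Ioi 1) :=
      ((exp_neg_integrableOn_Ioi 1 (by norm_num : (0 : ℝ) < 1 / 2)).const_mul 8)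
    refine hI.mono' (hmeas _ (Ioi_subset_Ioi zero_le_one) measurableSet_Ioi) ?_
    refine (ae_restrict_iff' measurableSet_Ioi).2 (ae_of_all _ fun t ht => ?_)
    have ht' : 1 ≤ t := le_of_lt ht
    rw [Real.norm_eq_abs, abs_of_nonneg (div_nonneg (Real.rpow_nonneg (by linarith) _)
      (Real.sinh_pos_iff.2 (by linarith)).le)]
    exact ic_archMajorant_le_exp ht'

/-- `min x y ≤ x^{3/4} y^{1/4}` for `x, y ≥ 0`. -/
theorem ic_min_le_geom {x y : ℝ} (hx : 0 ≤ x) (hy : 0 ≤ y) :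
    min x y ≤ x ^ (3 / 4 : ℝ) * y ^ (1 / 4 : ℝ) := by
  rcases le_total x y with h | h
  · rw [min_eq_left h]
    calc x = x ^ (3 / 4 : ℝ) * x ^ (1 / 4 : ℝ) := by
          rw [← Real.rpow_add' hx (by norm_num)]; norm_num
      _ ≤ x ^ (3 / 4 : ℝ) * y ^ (1 / 4 : ℝ) :=
          mul_le_mul_of_nonneg_left (Real.rpow_le_rpow hx h (by norm_num)) (Real.rpow_nonneg hx _)
  · rw [min_eq_right h]
    calc y = y ^ (3 / 4 : ℝ) * y ^ (1 / 4 : ℝ) := by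
          rw [← Real.rpow_add' hy (by norm_num)]; norm_num
      _ ≤ x ^ (3 / 4 : ℝ) * y ^ (1 / 4 : ℝ) :=
          mul_le_mul_of_nonneg_right (Real.rpow_le_rpow hy h (by norm_num)) (Real.rpow_nonneg hy _)

/-- `(m (m S)^{1/2})^{1/2} = m^{3/4} S^{1/4}` for `m, S ≥ 0`. -/
theorem ic_sqrt_form {m S : ℝ} (hm : 0 ≤ m) (hS : 0 ≤ S) :
    Real.sqrt (m * Real.sqrt (m * S)) = m ^ (3 / 4 : ℝ) * S ^ (1 / 4 : ℝ) := by
  rw [Real.sqrt_eq_rpow, Real.sqrt_eq_rpow, Real.mul_rpow hm (Real.rpow_nonneg (mul_nonneg hm hS) _),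
    ← Real.rpow_mul (mul_nonneg hm hS), Real.mul_rpow hm hS, ← mul_assoc,
    ← Real.rpow_add' hm (by norm_num)]
  norm_num

/-! ## The stub -/

/-- **Stub 5 of line `inner-cutoff-strong-EL` — the positive part of Bombieri's archimedean term.**
There is an absolute `K₀ ≥ 0` (`= ∫₀^∞ t^{1/4}/sinh t dt`) such that for every non-negative bounded
`C¹` function `g : ℝ → ℝ` with `|g'| ≤ S`,
`Re W_∞(g) ≤ K₀ (g(0) (g(0) S)^{1/2})^{1/2} = K₀ g(0)^{3/4} S^{1/4}`. -/
theorem stub_groundArchBound :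
    ∃ K₀ : ℝ, 0 ≤ K₀ ∧ ∀ (g : ℝ → ℝ) (S : ℝ), ContDiff ℝ 1 g → (∀ t, 0 ≤ g t) →
      (∃ K : ℝ, ∀ t, |g t| ≤ K) → (∀ t, |deriv g t| ≤ S) →
      (weilArchTermBombieri fun t => ((g t : ℝ) : ℂ)).re ≤ K₀ * Real.sqrt (g 0 * Real.sqrt (g 0 * S)) := by
  set ψ : ℝ → ℝ := fun t => t ^ (1 / 4 : ℝ) / Real.sinh t with hψ
  set K₀ : ℝ := ∫ t in Ioi (0 : ℝ), ψ t with hK₀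
  have hψ0 : ∀ t ∈ Ioi (0 : ℝ), 0 ≤ ψ t := fun t ht =>
    div_nonneg (Real.rpow_nonneg (le_of_lt (mem_Ioi.1 ht)) _) (Real.sinh_pos_iff.2 (mem_Ioi.1 ht)).le
  have hK₀0 : 0 ≤ K₀ := setIntegral_nonneg measurableSet_Ioi hψ0
  refine ⟨K₀, hK₀0, fun g S hg hg0 _ hgS => ?_⟩
  set m : ℝ := g 0 with hm
  have hm0 : 0 ≤ m := hg0 0
  have hS0 : 0 ≤ S := (abs_nonneg _).trans (hgS 0)
  -- the real integrand of Bombieri's term and its lower bound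
  set r : ℝ → ℝ := fun t => (Real.exp (t / 2) * (g t + g (-t)) - 2 * m) / (2 * Real.sinh t) with hr
  have hLip : ∀ t, |g t - m| ≤ S * |t| := by
    intro t
    have hdiff : ∀ x ∈ (univ : Set ℝ), DifferentiableAt ℝ g x := fun x _ =>
      (hg.differentiable one_ne_zero x)
    have h := (convex_univ).norm_image_sub_le_of_norm_deriv_le hdiff
      (fun x _ => by rw [Real.norm_eq_abs]; exact hgS x) (mem_univ 0) (mem_univ t)
    rw [Real.norm_eq_abs, Real.norm_eq_abs, sub_zero] at h
    exact h
  have hlow : ∀ t ∈ Ioi (0 : ℝ), -(m ^ (3 / 4 : ℝ) * S ^ (1 / 4 : ℝ) * ψ t) ≤ r t := by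
    intro t ht
    have ht0 : 0 < t := mem_Ioi.1 ht
    have hsinh : 0 < Real.sinh t := Real.sinh_pos_iff.2 ht0
    have hsum0 : 0 ≤ g t + g (-t) := add_nonneg (hg0 _) (hg0 _)
    -- numerator ≥ -2 min(m, S t)
    have hgt : m - S * t ≤ g t := by
      have h := hLip t; rw [abs_of_pos ht0] at h
      linarith [neg_abs_le (g t - m)]
    have hgnt : m - S * t ≤ g (-t) := by
      have h := hLip (-t); rw [abs_neg, abs_of_pos ht0] at h
      linarith [neg_abs_le (g (-t) - m)]
    have hexp : 1 ≤ Real.exp (t / 2) := Real.one_le_exp (by positivity)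
    have hnum : -(2 * min m (S * t)) ≤ Real.exp (t / 2) * (g t + g (-t)) - 2 * m := by
      have h1 : g t + g (-t) ≤ Real.exp (t / 2) * (g t + g (-t)) :=
        le_mul_of_one_le_left hsum0 hexp
      rcases le_total m (S * t) with hle | hle
      · rw [min_eq_left hle]; linarith
      · rw [min_eq_right hle]; linarith
    have hmin : min m (S * t) ≤ m ^ (3 / 4 : ℝ) * S ^ (1 / 4 : ℝ) * t ^ (1 / 4 : ℝ) := by
      have h := ic_min_le_geom hm0 (mul_nonneg hS0 ht0.le)
      rwa [Real.mul_rpow hS0 ht0.le, ← mul_assoc] at h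
    rw [hr]
    dsimp only
    rw [le_div_iff₀ (by positivity), hψ]
    dsimp only
    have e : -(m ^ (3 / 4 : ℝ) * S ^ (1 / 4 : ℝ) * (t ^ (1 / 4 : ℝ) / Real.sinh t)) * (2 * Real.sinh t) =
        -(2 * (m ^ (3 / 4 : ℝ) * S ^ (1 / 4 : ℝ) * t ^ (1 / 4 : ℝ))) := by
      field_simp
    rw [e]
    linarith
  -- the integral inequality `-∫ r ≤ m^{3/4} S^{1/4} K₀`
  have hmaj : IntegrableOn (fun t => m ^ (3 / 4 : ℝ) * S ^ (1 / 4 : ℝ) * ψ t) (Ioi 0) :=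
    ic_integrableOn_archMajorant.const_mul _
  have hint : -(∫ t in Ioi (0 : ℝ), r t) ≤ m ^ (3 / 4 : ℝ) * S ^ (1 / 4 : ℝ) * K₀ := by
    by_cases hri : IntegrableOn r (Ioi 0)
    · rw [← integral_neg, hK₀, ← integral_const_mul]
      refine setIntegral_mono_on hri.neg hmaj measurableSet_Ioi fun t ht => ?_
      have := hlow t ht
      linarith
    · rw [integral_undef hri, neg_zero]
      exact mul_nonneg (mul_nonneg (Real.rpow_nonneg hm0 _) (Real.rpow_nonneg hS0 _)) hK₀0
  -- the real part of Bombieri's term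
  have hre : (weilArchTermBombieri fun t => ((g t : ℝ) : ℂ)).re =
      -((Real.log (4 * π) + Real.eulerMascheroniConstant) * m + ∫ t in Ioi (0 : ℝ), r t) := by
    have e : ∫ t in Ioi (0 : ℝ), ((Real.exp (t / 2) : ℂ) * ((g t : ℂ) + (g (-t) : ℂ)) - 2 * (g 0 : ℂ)) /
        (2 * Real.sinh t : ℂ) = ((∫ t in Ioi (0 : ℝ), r t : ℝ) : ℂ) := by
      rw [← integral_complex_ofReal]
      refine integral_congr_ae (ae_of_all _ fun t => ?_)
      simp only [hr, hm]
      push_cast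
      ring
    rw [weilArchTermBombieri, e]
    simp [hm]
  have hL : 0 ≤ (Real.log (4 * π) + Real.eulerMascheroniConstant) * m := by
    refine mul_nonneg (add_nonneg (Real.log_nonneg ?_) ?_) hm0
    · have := Real.pi_gt_three; linarith
    · linarith [Real.one_half_lt_eulerMascheroniConstant]
  rw [hre, ic_sqrt_form hm0 hS0]
  linarith

end Summit.RiemannHypothesis.RiemannHypothesis.Theorems.GroundBartaFloor

end
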